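import Mathlib.Data.Int.GCD
import Literature.Computability.Complexity.CodeFPBudgets
import Literature.Computability.Complexity.CodeFPStrings
import HarnessLib

/-!
# Hallgren 2005 / class numbers under GRH — programming step P1: Mathlib's extended Euclid
# (`Int.gcd`, `Int.gcdA`, `Int.gcdB`) in the typed polynomial-time algebra `CodeFP`

Topic `Literature/Computability/Cryptography`; proof companion of `HallgrenClassGroup.lean`
(named fact `Hallgren2005_classNumber_qsolvable_of_GRH`). Real definitions and theorems; no named
fact. The clean block of the class-number algorithm composes forms with the lattice algorithm of
`HallgrenClassGroupLatticeHNF.lean` / `HallgrenClassGroupComposition.lean`, whose Bézout coefficients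
are EXACTLY Mathlib's `Int.gcdA`, `Int.gcdB` (= `Nat.xgcdAux`); the block must therefore compute
these very values. This file puts them in the typed `FP` algebra `CodeFP` (`Complexity/CodeFP.lean`:
maps between encoded types computed by polynomial-time string functions, closed under composition,
pairing, tests and folds with a polynomial accumulator bound):

* the loop form of `Nat.xgcdAux`: `xgcdStep` on states `(r, s, t, r', s', t')`, the terminal state
  `xfinal`, the step count `xsteps` with **`xsteps_le`** (`≤ 2 · size r + 1`, by halving every two
  steps), `iterate_xgcdStep` (enough iterations reach the terminal state) and `xfinal_snd`
  (its last three fields are `xgcdAux r s t r' s' t'`);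
* the **coefficient bound** `inv_iterate`: along the run from `(x, 1, 0, y, 0, 1)` the potentials
  `r|s'| + r'|s| ≤ y`, `r|t'| + r'|t| ≤ x` do not increase, so every coefficient is `≤ max x y + 1`
  — the polynomial accumulator bound the fold needs;
* `CodeFP` facts: `xgcdStepC`, `xgcdRunC`, **`natGcdABC`**
  (`(x, y) ↦ (gcd x y, gcdA x y, gcdB x y)`) and **`intGcdABC`** (`Int.gcd`, `Int.gcdA`, `Int.gcdB`
  through their sign conventions).

## References

* D. E. Knuth, *The Art of Computer Programming*, Vol. 2, 3rd ed., 1998, §4.5.2 Algorithm X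
  (extended Euclid; Lamé's bound) [KnuthTAOCP2].
* S. Arora, B. Barak, *Computational Complexity: A Modern Approach*, CUP 2009, §1.3 [AroraBarak2009].
-/

namespace Literature.Computability.Cryptography.Hallgren2005

namespace ClFP

open Literature.Computability.Complexity Literature.Computability.Complexity.CodeFP Polynomial

/-! ### The loop form of `Nat.xgcdAux` -/

/-- States `(r, s, t, r', s', t')` of the extended Euclidean loop. [cite: KnuthTAOCP2, §4.5.2 Algorithm X] -/
abbrev XSt : Type := ℕ × ℤ × ℤ × ℕ × ℤ × ℤ

/-- **One step of `Nat.xgcdAux`** (idle once `r = 0`):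
`(r, s, t, r', s', t') ↦ (r' mod r, s' − q s, t' − q t, r, s, t)`, `q = r' / r`.
[cite: KnuthTAOCP2, §4.5.2 Algorithm X] -/
def xgcdStep (st : XSt) : XSt :=
  if st.1 = 0 then st
  else (st.2.2.2.1 % st.1, st.2.2.2.2.1 - (st.2.2.2.1 / st.1 : ℕ) * st.2.1,
    st.2.2.2.2.2 - (st.2.2.2.1 / st.1 : ℕ) * st.2.2.1, st.1, st.2.1, st.2.2.1)

/-- The terminal state of the loop. [folklore] -/
def xfinal (r : ℕ) (s t : ℤ) (r' : ℕ) (s' t' : ℤ) : XSt :=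
  if _hr : r = 0 then (0, s, t, r', s', t')
  else xfinal (r' % r) (s' - (r' / r : ℕ) * s) (t' - (r' / r : ℕ) * t) r s t
termination_by r
decreasing_by exact Nat.mod_lt _ (Nat.pos_of_ne_zero (by assumption))

/-- The number of active steps of the loop. [folklore] -/
def xsteps (r r' : ℕ) : ℕ :=
  if _h : r = 0 then 0 else xsteps (r' % r) r + 1
termination_by r
decreasing_by exact Nat.mod_lt _ (Nat.pos_of_ne_zero (by assumption))

/-- `xfinal` at `r = 0`. [folklore] -/
theorem xfinal_zero (s t : ℤ) (r' : ℕ) (s' t' : ℤ) : xfinal 0 s t r' s' t' = (0, s, t, r', s', t') := by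
  rw [xfinal, dif_pos rfl]

/-- `xfinal` at `r > 0`. [folklore] -/
theorem xfinal_pos {r : ℕ} (hr : r ≠ 0) (s t : ℤ) (r' : ℕ) (s' t' : ℤ) :
    xfinal r s t r' s' t' = xfinal (r' % r) (s' - (r' / r : ℕ) * s) (t' - (r' / r : ℕ) * t) r s t := by
  rw [xfinal, dif_neg hr]

/-- `xsteps` at `r = 0`. [folklore] -/
theorem xsteps_zero (r' : ℕ) : xsteps 0 r' = 0 := by
  rw [xsteps, dif_pos rfl]

/-- `xsteps` at `r > 0`. [folklore] -/
theorem xsteps_pos {r : ℕ} (hr : r ≠ 0) (r' : ℕ) : xsteps r r' = xsteps (r' % r) r + 1 := by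
  rw [xsteps, dif_neg hr]

/-- **Enough iterations reach the terminal state.** [folklore] -/
theorem iterate_xgcdStep : ∀ (r : ℕ) (s t : ℤ) (r' : ℕ) (s' t' : ℤ) (n : ℕ), xsteps r r' ≤ n →
    xgcdStep^[n] (r, s, t, r', s', t') = xfinal r s t r' s' t' := by
  intro r
  induction r using Nat.strong_induction_on with
  | _ r ih =>
    intro s t r' s' t' n hn
    rcases Nat.eq_zero_or_pos r with rfl | hr
    · rw [xfinal_zero]
      exact Function.iterate_fixed (by simp [xgcdStep]) n
    · rw [xsteps_pos hr.ne'] at hn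
      obtain ⟨n, rfl⟩ : ∃ m, n = m + 1 := ⟨n - 1, by omega⟩
      rw [Function.iterate_succ_apply, xfinal_pos hr.ne']
      have hstep : xgcdStep (r, s, t, r', s', t') =
          (r' % r, s' - (r' / r : ℕ) * s, t' - (r' / r : ℕ) * t, r, s, t) := by
        simp [xgcdStep, hr.ne']
      rw [hstep]
      exact ih (r' % r) (Nat.mod_lt _ hr) _ _ _ _ _ n (by omega)

/-- **The terminal state carries `xgcdAux`** in its last three fields. [folklore] -/
theorem xfinal_snd : ∀ (r : ℕ) (s t : ℤ) (r' : ℕ) (s' t' : ℤ),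
    (xfinal r s t r' s' t').2.2.2 = Nat.xgcdAux r s t r' s' t' := by
  intro r
  induction r using Nat.strong_induction_on with
  | _ r ih =>
    intro s t r' s' t'
    rcases Nat.eq_zero_or_pos r with rfl | hr
    · rw [xfinal_zero, Nat.xgcd_zero_left]
    · rw [xfinal_pos hr.ne', Nat.xgcdAux_rec hr]
      exact ih (r' % r) (Nat.mod_lt _ hr) _ _ _ _ _

/-- The first field of the terminal state is `0`. [folklore] -/
theorem xfinal_fst : ∀ (r : ℕ) (s t : ℤ) (r' : ℕ) (s' t' : ℤ), (xfinal r s t r' s' t').1 = 0 := by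
  intro r
  induction r using Nat.strong_induction_on with
  | _ r ih =>
    intro s t r' s' t'
    rcases Nat.eq_zero_or_pos r with rfl | hr
    · rw [xfinal_zero]
    · rw [xfinal_pos hr.ne']; exact ih (r' % r) (Nat.mod_lt _ hr) _ _ _ _ _

/-- **Step count: `xsteps r r' ≤ 2 · size r`** (after two steps the first argument is at most
halved: `r₂ = r mod r₁ ≤ r − r₁` and `r₂ < r₁`). [cite: KnuthTAOCP2, §4.5.3 (Lamé)] -/
theorem xsteps_le : ∀ r r' : ℕ, xsteps r r' ≤ 2 * Nat.size r := by
  intro r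
  induction r using Nat.strong_induction_on with
  | _ r ih =>
    intro r'
    rcases Nat.eq_zero_or_pos r with rfl | hr
    · rw [xsteps_zero]; exact Nat.zero_le _
    · rw [xsteps_pos hr.ne']
      set r₁ := r' % r with hr₁
      have hr₁r : r₁ < r := Nat.mod_lt _ hr
      rcases Nat.eq_zero_or_pos r₁ with h0 | hr₁pos
      · rw [h0, xsteps_zero]
        have : 1 ≤ Nat.size r := Nat.size_pos.2 hr
        omega
      · rw [xsteps_pos hr₁pos.ne']
        set r₂ := r % r₁ with hr₂
        have hr₂lt : r₂ < r₁ := Nat.mod_lt _ hr₁pos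
        -- `r₂ ≤ r - r₁`
        have hle : r₂ ≤ r - r₁ := by
          have hq : 1 ≤ r / r₁ := Nat.div_pos hr₁r.le hr₁pos
          have := Nat.div_add_mod r r₁
          have : r₁ * 1 ≤ r₁ * (r / r₁) := Nat.mul_le_mul_left _ hq
          omega
        have h2 : 2 * r₂ < r + 1 := by omega
        have hsize : Nat.size r₂ + 1 ≤ Nat.size r := by
          rcases Nat.eq_zero_or_pos r₂ with h0 | hpos
          · rw [h0, Nat.size_zero]; exact Nat.size_pos.2 hr
          · have : Nat.size (2 * r₂) = Nat.size r₂ + 1 := by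
              rw [show 2 * r₂ = r₂ <<< 1 by rw [Nat.shiftLeft_eq]; ring, Nat.size_shiftLeft hpos.ne']
            rw [← this]
            exact Nat.size_le_size (by omega)
        have := ih r₂ (hr₂lt.trans hr₁r) r₁
        omega

/-! ### The coefficient bound along the run from `(x, 1, 0, y, 0, 1)` -/

/-- The loop invariant: the potentials `r|s'| + r'|s| ≤ y`, `r|t'| + r'|t| ≤ x`, the remainders
`≤ max x y`, and all coefficients `≤ max x y + 1`. [cite: KnuthTAOCP2, §4.5.2 (bounds on the multipliers)] -/
def Inv (x y : ℕ) : XSt → Prop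
  | (r, s, t, r', s', t') =>
    (r : ℤ) * |s'| + r' * |s| ≤ y ∧ (r : ℤ) * |t'| + r' * |t| ≤ x ∧ r ≤ max x y ∧ r' ≤ max x y ∧
      |s| ≤ max x y + 1 ∧ |t| ≤ max x y + 1 ∧ |s'| ≤ max x y + 1 ∧ |t'| ≤ max x y + 1

/-- The invariant holds initially. [folklore] -/
theorem inv_init (x y : ℕ) : Inv x y (x, 1, 0, y, 0, 1) := by
  simp only [Inv, abs_zero, abs_one, mul_zero, mul_one, zero_add, add_zero, le_refl, le_max_left,
    le_max_right, true_and]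
  refine ⟨?_, ?_, ?_, ?_⟩ <;> push_cast <;> linarith [le_max_left (x : ℤ) y, le_max_right (x : ℤ) y,
    (Nat.cast_nonneg x : (0 : ℤ) ≤ x)]

/-- **The invariant is preserved by a step** (`|s' − q s| ≤ |s'| + q|s|` and `r' = q r + (r' mod r)`).
[cite: KnuthTAOCP2, §4.5.2] -/
theorem inv_step {x y : ℕ} {st : XSt} (h : Inv x y st) : Inv x y (xgcdStep st) := by
  obtain ⟨r, s, t, r', s', t'⟩ := st
  obtain ⟨hIs, hIt, hr, hr', hs, ht, hs', ht'⟩ := h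
  by_cases h0 : r = 0
  · have : xgcdStep (r, s, t, r', s', t') = (r, s, t, r', s', t') := by simp [xgcdStep, h0]
    rw [this]
    exact ⟨hIs, hIt, hr, hr', hs, ht, hs', ht'⟩
  · have hrpos : 0 < r := Nat.pos_of_ne_zero h0
    set q : ℕ := r' / r with hq
    have hstepeq : xgcdStep (r, s, t, r', s', t') = (r' % r, s' - q * s, t' - q * t, r, s, t) := by
      simp [xgcdStep, h0, hq]
    rw [hstepeq]
    have hdiv : (r' : ℤ) = q * r + (r' % r : ℕ) := by
      have := Nat.div_add_mod r' r
      rw [hq]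
      exact_mod_cast (by linarith [this] : r' = r' / r * r + r' % r)
    have hrZ : (1 : ℤ) ≤ r := by exact_mod_cast hrpos
    -- the potentials do not increase
    have key_s : ((r' % r : ℕ) : ℤ) * |s| + r * |s' - q * s| ≤ y := by
      have h1 : |s' - (q : ℤ) * s| ≤ |s'| + q * |s| := by
        calc |s' - (q : ℤ) * s| ≤ |s'| + |(q : ℤ) * s| := abs_sub _ _
          _ = |s'| + q * |s| := by rw [abs_mul, Nat.abs_cast]
      nlinarith [abs_nonneg s, abs_nonneg s', hIs, hdiv, (Nat.cast_nonneg r : (0 : ℤ) ≤ r)]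
    have key_t : ((r' % r : ℕ) : ℤ) * |t| + r * |t' - q * t| ≤ x := by
      have h1 : |t' - (q : ℤ) * t| ≤ |t'| + q * |t| := by
        calc |t' - (q : ℤ) * t| ≤ |t'| + |(q : ℤ) * t| := abs_sub _ _
          _ = |t'| + q * |t| := by rw [abs_mul, Nat.abs_cast]
      nlinarith [abs_nonneg t, abs_nonneg t', hIt, hdiv, (Nat.cast_nonneg r : (0 : ℤ) ≤ r)]
    have hmod0 : (0 : ℤ) ≤ ((r' % r : ℕ) : ℤ) := Nat.cast_nonneg _
    refine ⟨key_s, key_t, (Nat.mod_lt _ hrpos).le.trans hr, hr, ?_, ?_, hs, ht⟩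
    · have h2 : (r : ℤ) * |s' - q * s| ≤ y := by nlinarith [abs_nonneg s, key_s]
      have h3 : |s' - (q : ℤ) * s| ≤ y := by nlinarith [abs_nonneg (s' - (q : ℤ) * s)]
      push_cast
      linarith [le_max_right (x : ℤ) y]
    · have h2 : (r : ℤ) * |t' - q * t| ≤ x := by nlinarith [abs_nonneg t, key_t]
      have h3 : |t' - (q : ℤ) * t| ≤ x := by nlinarith [abs_nonneg (t' - (q : ℤ) * t)]
      push_cast
      linarith [le_max_left (x : ℤ) y]

/-- The invariant along the run. [folklore] -/
theorem inv_iterate (x y n : ℕ) : Inv x y (xgcdStep^[n] (x, 1, 0, y, 0, 1)) := by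
  induction n with
  | zero => exact inv_init x y
  | succ n ih => rw [Function.iterate_succ_apply']; exact inv_step ih

/-! ### `CodeFP` facts -/

/-- The code of loop states. [folklore] -/
abbrev stE : XSt → List Bool := pairE natE (pairE intE (pairE intE (pairE natE (pairE intE intE))))

/-- An integer of absolute value `≤ B` has a code of length `≤ 3 size B + 2`. [folklore] -/
theorem length_intE_le_of_abs_le {z : ℤ} {B : ℕ} (h : |z| ≤ B) : (intE z).length ≤ 3 * Nat.size B + 2 := by
  refine (Brick.length_dpEnc_le z).trans ?_
  have : z.natAbs ≤ B := by
    have h' : ((z.natAbs : ℕ) : ℤ) ≤ B := by rw [Int.natCast_natAbs]; exact h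
    exact_mod_cast h'
  have := Nat.size_le_size this
  omega

/-- Code length of a state under the invariant: linear in `size (max x y + 1)`. [folklore] -/
theorem length_stE_le_of_inv {x y : ℕ} {st : XSt} (h : Inv x y st) :
    (stE st).length ≤ 25 * Nat.size (max x y + 1) + 24 := by
  obtain ⟨r, s, t, r', s', t'⟩ := st
  obtain ⟨-, -, hr, hr', hs, ht, hs', ht'⟩ := h
  have e : stE (r, s, t, r', s', t') = boolPair (natE r) (boolPair (intE s) (boolPair (intE t)
      (boolPair (natE r') (boolPair (intE s') (intE t'))))) := rfl
  rw [e]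
  simp only [length_boolPair]
  have h1 : (natE r).length ≤ Nat.size (max x y + 1) := by rw [length_natE]; exact Nat.size_le_size (by omega)
  have h2 : (natE r').length ≤ Nat.size (max x y + 1) := by rw [length_natE]; exact Nat.size_le_size (by omega)
  have h3 := length_intE_le_of_abs_le (z := s) (B := max x y + 1) (by exact_mod_cast hs)
  have h4 := length_intE_le_of_abs_le (z := t) (B := max x y + 1) (by exact_mod_cast ht)
  have h5 := length_intE_le_of_abs_le (z := s') (B := max x y + 1) (by exact_mod_cast hs')
  have h6 := length_intE_le_of_abs_le (z := t') (B := max x y + 1) (by exact_mod_cast ht')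
  omega

/-- **`xgcdStep` is computed on codes.** [cite: AroraBarak2009, §1.3] -/
theorem xgcdStepC : CodeFP stE stE xgcdStep := by
  -- fields
  have hr : CodeFP stE natE (fun st => st.1) := fst _ _
  have hs : CodeFP stE intE (fun st => st.2.1) := (snd _ _).fst'
  have ht : CodeFP stE intE (fun st => st.2.2.1) := (snd _ _).snd'.fst'
  have hr' : CodeFP stE natE (fun st => st.2.2.2.1) := (snd _ _).snd'.snd'.fst'
  have hs' : CodeFP stE intE (fun st => st.2.2.2.2.1) := (snd _ _).snd'.snd'.snd'.fst'
  have ht' : CodeFP stE intE (fun st => st.2.2.2.2.2) := (snd _ _).snd'.snd'.snd'.snd'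
  have hq : CodeFP stE intE (fun st => ((st.2.2.2.1 / st.1 : ℕ) : ℤ)) := intOfNat.comp (natDiv.comp (hr'.pair hr))
  have hnew : CodeFP stE stE (fun st => (st.2.2.2.1 % st.1, st.2.2.2.2.1 - (st.2.2.2.1 / st.1 : ℕ) * st.2.1,
      st.2.2.2.2.2 - (st.2.2.2.1 / st.1 : ℕ) * st.2.2.1, st.1, st.2.1, st.2.2.1)) :=
    (natMod.comp (hr'.pair hr)).pair ((intSub.comp (hs'.pair (intMul.comp (hq.pair hs)))).pair
      ((intSub.comp (ht'.pair (intMul.comp (hq.pair ht)))).pair (hr.pair (hs.pair ht))))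
  have htest : CodeFP stE bitE (fun st => decide (st.1 = 0)) := natEq.comp (hr.pair (const stE 0))
  refine (ite htest (CodeFP.id stE) hnew).congr fun st => ?_
  by_cases h : st.1 = 0
  · simp [xgcdStep, h]
  · simp [xgcdStep, h]

/-- Iterating along a unit list is a fold. [folklore] -/
theorem foldl_units_xgcdStep (st : XSt) (l : List Unit) :
    l.foldl (fun b _ => xgcdStep b) st = xgcdStep^[l.length] st := by
  induction l generalizing st with
  | nil => rfl
  | cons _ l ih => rw [List.foldl_cons, ih, List.length_cons, Function.iterate_succ_apply]

/-- **The run from `(x, 1, 0, y, 0, 1)` along a unit budget is computed on codes** (fold with the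
polynomial accumulator bound from `inv_iterate`). [cite: AroraBarak2009, §1.3 (polynomially bounded loops)] -/
theorem xgcdRunC : CodeFP (pairE (pairE natE natE) (rawE unitE)) stE
    (fun p => xgcdStep^[p.2.length] (p.1.1, 1, 0, p.1.2, 0, 1)) := by
  have hinit : CodeFP (pairE natE natE) stE (fun p => (p.1, (1 : ℤ), (0 : ℤ), p.2, (0 : ℤ), (1 : ℤ))) :=
    (fst _ _).pair ((const _ 1).pair ((const _ 0).pair ((snd _ _).pair ((const _ 0).pair (const _ 1)))))
  have hstep : CodeFP (pairE (pairE natE natE) (pairE unitE stE)) stE (fun t => xgcdStep t.2.2) :=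
    xgcdStepC.comp (snd _ _).snd'
  have h := foldl (σ := ℕ × ℕ) (α := Unit) (β := XSt) (eσ := pairE natE natE) (eα := unitE) (eβ := stE)
    (step := fun _ _ b => xgcdStep b) (init := fun p => (p.1, 1, 0, p.2, 0, 1)) hstep hinit
    (C 13 * X + C 49) (fun p l₁ l₂ => by
      rw [foldl_units_xgcdStep]
      refine (length_stE_le_of_inv (inv_iterate p.1 p.2 l₁.length)).trans ?_
      simp only [eval_add, eval_mul, eval_C, eval_X, pairE_apply, length_boolPair]
      have h1 : Nat.size (max p.1 p.2 + 1) ≤ Nat.size (max p.1 p.2) + 1 := by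
        have := Nat.size_le_size (show max p.1 p.2 + 1 ≤ 2 * max p.1 p.2 + 1 by omega)
        rcases Nat.eq_zero_or_pos (max p.1 p.2) with h0 | hpos
        · rw [h0]; decide
        · have : Nat.size (2 * max p.1 p.2) = Nat.size (max p.1 p.2) + 1 := by
            rw [show 2 * max p.1 p.2 = max p.1 p.2 <<< 1 by rw [Nat.shiftLeft_eq]; ring,
              Nat.size_shiftLeft hpos.ne']
          have h2 := Nat.size_le_size (show max p.1 p.2 + 1 ≤ 2 * max p.1 p.2 by omega)
          omega
      have h2 : Nat.size (max p.1 p.2) ≤ (natE p.1).length + (natE p.2).length := by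
        rw [length_natE, length_natE]
        rcases le_total p.1 p.2 with h | h
        · rw [max_eq_right h]; omega
        · rw [max_eq_left h]; omega
      nlinarith [h1, h2])
  exact h.congr fun p => by rw [foldl_units_xgcdStep]

/-- The unit budget `2 size x + 1` from `(x, y)`. [folklore] -/
theorem budgetC : CodeFP (pairE natE natE) (rawE unitE) (fun p => List.replicate (2 * Nat.size p.1 + 1) ()) := by
  have hlen : CodeFP (pairE natE natE) unE (fun p => Nat.size p.1) :=
    (strLength.comp (strOfNat.comp (fst _ _))).congr fun p => by simp [length_natE]
  exact (replicateUnit.comp (unSucc.comp ((unMulConst 2).comp hlen))).congr fun p => by simp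

/-- **`(x, y) ↦ (gcd x y, gcdA x y, gcdB x y)` is computed on codes.** [cite: KnuthTAOCP2, §4.5.2 Algorithm X] -/
theorem natGcdABC : CodeFP (pairE natE natE) (pairE natE (pairE intE intE))
    (fun p => (Nat.gcd p.1 p.2, Nat.gcdA p.1 p.2, Nat.gcdB p.1 p.2)) := by
  have h := (xgcdRunC.comp ((CodeFP.id _).pair budgetC)).snd'.snd'.snd'
  refine h.congr fun p => ?_
  simp only [List.length_replicate, id]
  rw [iterate_xgcdStep _ _ _ _ _ _ _ ((xsteps_le p.1 p.2).trans (Nat.le_succ _)), xfinal_snd, Nat.xgcdAux_val,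
    Nat.xgcd_val]

/-- `Int.gcdA` through `Nat.gcdA`. [folklore] -/
theorem int_gcdA_eq (a b : ℤ) : Int.gcdA a b = if a < 0 then -Nat.gcdA a.natAbs b.natAbs else Nat.gcdA a.natAbs b.natAbs := by
  cases a with
  | ofNat m => simp [Int.gcdA]
  | negSucc m => rw [if_pos (Int.negSucc_lt_zero m)]; rfl

/-- `Int.gcdB` through `Nat.gcdB`. [folklore] -/
theorem int_gcdB_eq (a b : ℤ) : Int.gcdB a b = if b < 0 then -Nat.gcdB a.natAbs b.natAbs else Nat.gcdB a.natAbs b.natAbs := by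
  cases b with
  | ofNat n => cases a <;> simp [Int.gcdB]
  | negSucc n => rw [if_pos (Int.negSucc_lt_zero n)]; cases a <;> rfl

/-- **`(a, b) ↦ (Int.gcd a b, Int.gcdA a b, Int.gcdB a b)` is computed on codes.** [cite: KnuthTAOCP2, §4.5.2 Algorithm X] -/
theorem intGcdABC : CodeFP (pairE intE intE) (pairE natE (pairE intE intE))
    (fun p => (Int.gcd p.1 p.2, Int.gcdA p.1 p.2, Int.gcdB p.1 p.2)) := by
  have habs : CodeFP (pairE intE intE) (pairE natE natE) (fun p => (p.1.natAbs, p.2.natAbs)) :=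
    (intNatAbs.comp (fst _ _)).pair (intNatAbs.comp (snd _ _))
  have hn := natGcdABC.comp habs
  have hA : CodeFP (pairE intE intE) intE (fun p => Nat.gcdA p.1.natAbs p.2.natAbs) := hn.snd'.fst'
  have hB : CodeFP (pairE intE intE) intE (fun p => Nat.gcdB p.1.natAbs p.2.natAbs) := hn.snd'.snd'
  have ha0 : CodeFP (pairE intE intE) bitE (fun p => decide (p.1 < 0)) := intLt.comp ((fst _ _).pair (const _ 0))
  have hb0 : CodeFP (pairE intE intE) bitE (fun p => decide (p.2 < 0)) := intLt.comp ((snd _ _).pair (const _ 0))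
  have hgA := ite ha0 (intNeg.comp hA) hA
  have hgB := ite hb0 (intNeg.comp hB) hB
  refine (hn.fst'.pair (hgA.pair hgB)).congr fun p => ?_
  ext
  · rfl
  · simp only [int_gcdA_eq]; split_ifs <;> simp_all
  · simp only [int_gcdB_eq]; split_ifs <;> simp_all

end ClFP

end Literature.Computability.Cryptography.Hallgren2005
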